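import Summits.ResolutionOfSingularities.ResolutionOfSingularities.Theorems.PurelyInseparableDim4ResConeShadeTwoSwitch
import HarnessLib
import HarnessLib.Audit.Tags

/-!
# Purely inseparable four-folds — K2(p), PHASE `d = 2`, PART IX: the switch kill on a LOCAL corner window (six states, no
# ambient chain; every prime) — the shape a finite Tschirnhaus frame produces

[OURS · counted 0 · cell `res-dim4-pi` · seat res-dim4-p-7 g3 · K2(p) lane (holder res-dim4-p-12 lineage; desk WORDs #82 (c),
#96 (a)); hand analysis res-dim4-idea-4 (card I-4-6 (C3-2L)).]  Nothing here proves K2(p), `NoIsolatedTrap p p`, or resolution of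
singularities in dimension ≥ 4 / characteristic `p`.  AI kernel work, weaker than expert review.

`…ShadeTwoSwitch.no_corner_switch_window` is stated along an infinite witnessed chain.  A Tschirnhaus frame straight to finite
order only yields FINITELY many honest corner states, so this file re-plumbs the same word-law argument for a LOCAL window:
six states `s 0, …, s 5` with `s (i+1) = step p univ (j i) 0 (s i)` (`i ≤ 4`), each isolated with `x^r ∣ F`, `ord₀ F = W + 2`,
`p ≤ W + 1`, `W + 4 ≤ 2p`, shade `2`; ledger `W = p − 1` with `v` light at `1`, `u` light at `2`; charts `j 0 = u`, `j 1 = v`,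
`j 2, j 3, j 4 ∈ {u, v}` ⇒ **`no_corner_switch_window_local`**: contradiction.  Per-index corner facts `cornerAtLocal` come
straight from `…ShadeTwoStep`.
bears_on: LADDER-RESOLUTION:D157-DOOR2 (res-dim4-pi · K2(p) · phase d = 2).  Supports stmt-ResolutionOfSingularities-16155
(helper).
-/

set_option linter.dupNamespace false -- mandated namespace of this single-conjunct summit

noncomputable section

namespace Summit.ResolutionOfSingularities.ResolutionOfSingularities.Theorems.PIDim4

namespace ResCone

open MvPolynomial Finset
open Literature.AlgebraicGeometry.Resolution
open Literature.AlgebraicGeometry.Resolution.CentreBlowup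
open Literature.AlgebraicGeometry.Resolution.Hauser2010
open Literature.AlgebraicGeometry.Resolution.HauserPerlega2019

variable {K : Type} [Field K] [DecidableEq K]

section Local

variable {p : ℕ} [hp : Fact p.Prime] {s : ℕ → State K} {j : ℕ → Fin 4}

/-! ## §1 One corner step of a local window -/

/-- **A corner step of a local window** (`k ≤ 4`): the new boundary, the `x_{j k}`-freeness of the quadric, no pure cube,
backward and forward transport, and the axis witnesses of the child. [OURS · K2(p) phase d = 2] [folklore] -/
theorem cornerAtLocal
    (hS : ∀ i, i ≤ 5 → IsIsolated p (s i).F ∧ (∀ e ∈ (s i).F.support, (s i).r ≤ e) ∧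
      ordZero (s i).F = (((s i).r.degree + 2 : ℕ) : ℕ∞) ∧ p ≤ (s i).r.degree + 1 ∧ (s i).r.degree + 4 ≤ 2 * p ∧
      (s i).shade = 2)
    (hT : ∀ i, i ≤ 4 → s (i + 1) = CentreBlowup.step p Finset.univ (j i) (0 : Fin 4 → K) (s i)) (k : ℕ) (hk : k ≤ 4) :
    (s (k + 1)).r = (s k).r.update (j k) ((s k).r.degree + 2 - p) ∧
      (∀ μ : Fin 4 →₀ ℕ, μ.degree = 2 → μ (j k) ≠ 0 → (s k).r + μ ∉ (s k).F.support) ∧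
      (s k).r + Finsupp.single (j k) 3 ∉ (s k).F.support ∧
      (∀ m' : Fin 4 →₀ ℕ, (s (k + 1)).r + m' ∈ (s (k + 1)).F.support →
        ∃ m : Fin 4 →₀ ℕ, (s k).r + m ∈ (s k).F.support ∧ 2 ≤ m.degree ∧ m' = m.update (j k) (m.degree - 2)) ∧
      (∀ m : Fin 4 →₀ ℕ, 2 ≤ m.degree → (m.update (j k) (m.degree - 2)).degree ≤ 4 → (s k).r + m ∈ (s k).F.support →
        (s (k + 1)).r + m.update (j k) (m.degree - 2) ∈ (s (k + 1)).F.support) ∧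
      (∀ a, ∃ m : Fin 4 →₀ ℕ, (s (k + 1)).r + m ∈ (s (k + 1)).F.support ∧
        (s (k + 1)).r.degree + m.degree < (s (k + 1)).r a + m a + p) := by
  have hp2 : 2 ≤ p := hp.out.two_le
  obtain ⟨hiso, hr, ho, hpW, hW2, hsh⟩ := hS k (by omega)
  obtain ⟨hiso1, hr1, ho1, hpW1, hW21, hsh1⟩ := hS (k + 1) (by omega)
  have hTk := hT k hk
  have heq : (CentreBlowup.step p Finset.univ (j k) (0 : Fin 4 → K) (s k)).shade = (s k).shade := by
    rw [← hTk, hsh1, hsh]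
  have hiso' : IsIsolated p (CentreBlowup.step p Finset.univ (j k) (0 : Fin 4 → K) (s k)).F := by rw [← hTk]; exact hiso1
  have hr1' : ∀ e ∈ (CentreBlowup.step p Finset.univ (j k) (0 : Fin 4 → K) (s k)).F.support,
      (CentreBlowup.step p Finset.univ (j k) (0 : Fin 4 → K) (s k)).r ≤ e := by rw [← hTk]; exact hr1
  refine ⟨?_, fun μ hμ hμj => not_mem_support_add_of_apply_ne_zero (p := p) (j k) rfl ho hr hpW hW2 heq hμ hμj,
    not_mem_support_add_three_single hp2 (j k) rfl ho hr hpW hW2 heq hiso' hr1', fun m' hm' => ?_,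
    fun m hm2 hm4 hm => ?_, fun a => ?_⟩
  · rw [hTk, shadeTwo_step_r (j k) rfl (s k) ho hr]
    congr 1
    ext i
    rw [Finsupp.filter_apply, if_pos (Pi.zero_apply _)]
  · rw [hTk] at hm'
    exact exists_source_of_corner (j k) (s k) rfl ho hr (by omega) hm'
  · have hW1 : p ≤ (CentreBlowup.step p Finset.univ (j k) (0 : Fin 4 → K) (s k)).r.degree + 1 := by
      rw [← hTk]; exact hpW1
    have hW21' : (CentreBlowup.step p Finset.univ (j k) (0 : Fin 4 → K) (s k)).r.degree + 4 ≤ 2 * p := by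
      rw [← hTk]; exact hW21
    have hnp := not_isPthPowerExponent_add_of_shadeTwo hp2 hiso' hr1' rfl hW1 hW21' hm4
    rw [hTk, MvPolynomial.mem_support_iff, coeff_corner_of_not_isPthPowerExponent (j k) (s k) rfl ho hr (by omega) hm2 hnp]
    exact MvPolynomial.mem_support_iff.mp hm
  · obtain ⟨e, he, hlt⟩ := exists_degree_lt_apply_add_of_isIsolated hiso1 a
    have hle : (s (k + 1)).r ≤ e := hr1 e he
    obtain ⟨m, rfl⟩ : ∃ m, e = (s (k + 1)).r + m := ⟨e - (s (k + 1)).r, (add_tsub_cancel_of_le hle).symm⟩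
    rw [map_add, Finsupp.add_apply] at hlt
    exact ⟨m, he, by omega⟩

/-! ## §2 Low witnesses right after a corner step -/

/-- **LOW WITNESSES RIGHT AFTER A CORNER STEP** (no stability hypothesis): after a corner step in chart `c' = j k`, a
monomial `x^{r_{k+1} + m′}` of `F_{k+1}` with `|m′| ≤ m′_a + 1` for a letter `a ≠ c'` is either a QUADRIC monomial
involving `x_a`, or `x^{r + 2e_a + e_{c'}}` (sourced by itself), or `x^{r + 3e_a + e_{c'}}` (sourced by the pure cube
`x^{r + 3e_a}`).  (Sources have `2a + b + c ≤ 3`; `x_{c'}², x_{c'}x_a, x_{c'}³` are excluded at the parent.)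
[OURS · K2(p) phase d = 2] [folklore] -/
theorem low_witness_after_corner_local (hS : ∀ i, i ≤ 5 → IsIsolated p (s i).F ∧ (∀ e ∈ (s i).F.support, (s i).r ≤ e) ∧
      ordZero (s i).F = (((s i).r.degree + 2 : ℕ) : ℕ∞) ∧ p ≤ (s i).r.degree + 1 ∧ (s i).r.degree + 4 ≤ 2 * p ∧
      (s i).shade = 2)
    (hT : ∀ i, i ≤ 4 → s (i + 1) = CentreBlowup.step p Finset.univ (j i) (0 : Fin 4 → K) (s i)) (k : ℕ) (hk : k ≤ 4) {a : Fin 4} (ha : a ≠ j k)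
    {m' : Fin 4 →₀ ℕ} (hm' : (s (k + 1)).r + m' ∈ (s (k + 1)).F.support) (hlow : m'.degree ≤ m' a + 1) :
    (m'.degree = 2 ∧ 1 ≤ m' a) ∨
      (m' = Finsupp.single a 2 + Finsupp.single (j k) 1 ∧
        (s k).r + (Finsupp.single a 2 + Finsupp.single (j k) 1) ∈ (s k).F.support) ∨
      (m' = Finsupp.single a 3 + Finsupp.single (j k) 1 ∧ (s k).r + Finsupp.single a 3 ∈ (s k).F.support) := by
  obtain ⟨-, hfree, hcube, hsrc, -, -⟩ := cornerAtLocal hS hT k hk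
  obtain ⟨m, hm, hm2, hupd⟩ := hsrc m' hm'
  obtain ⟨hmj, hmi⟩ := apply_of_eq_update hupd
  have hma : m' a = m a := hmi a ha
  have hdeg' := degree_update_add m (j k) (m.degree - 2)
  rw [← hupd] at hdeg'
  have hle2 := apply_add_apply_le_degree m ha
  rcases Nat.lt_or_ge m.degree 3 with hlt3 | hge3
  · -- `|m| = 2`: the child monomial is the parent one, a quadric monomial involving `x_a`
    have hdeg2 : m.degree = 2 := by omega
    have hmj0 : m (j k) = 0 := by
      by_contra hne
      exact hfree m hdeg2 hne hm
    left
    constructor <;> omega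
  · have hdeg3 : m.degree = 3 := by omega
    have hsum : m.degree = m a + m (j k) := by omega
    have hrest := apply_eq_zero_of_degree_eq m ha hsum
    have hmeq := eq_single_add_single_of_forall m ha hrest
    rcases (show m a = 0 ∨ m a = 1 ∨ m a = 2 ∨ m a = 3 by omega) with h0 | h1 | h2 | h3
    · exfalso
      have hjk : m (j k) = 3 := by omega
      rw [h0, hjk, Finsupp.single_zero, zero_add] at hmeq
      exact hcube (hmeq ▸ hm)
    · -- `x_{c'}² x_a ↦ x_{c'} x_a`: a quadric monomial involving `x_a`
      left
      constructor <;> omega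
    · right; left
      have hjk : m (j k) = 1 := by omega
      rw [h2, hjk] at hmeq
      refine ⟨?_, hmeq ▸ hm⟩
      ext i
      by_cases hi : i = j k
      · rw [hi, hmj, hdeg3, Finsupp.add_apply, Finsupp.single_apply, if_neg ha, Finsupp.single_eq_same]
      · rw [hmi i hi, hmeq]
    · right; right
      have hjk : m (j k) = 0 := by omega
      rw [h3, hjk, Finsupp.single_zero, add_zero] at hmeq
      refine ⟨?_, hmeq ▸ hm⟩
      ext i
      by_cases hi : i = j k
      · rw [hi, hmj, hdeg3, Finsupp.add_apply, Finsupp.single_apply, if_neg ha, Finsupp.single_eq_same]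
      · rw [hmi i hi, hmeq, Finsupp.add_apply, Finsupp.single_apply (a := j k), if_neg (fun h => hi h.symm), add_zero]

omit [DecidableEq K] hp in
/-- **An axis witness for a light letter**: on the ledger `W = p − 1`, `r_a = 1`, isolation of `s k` gives a monomial
`x^{r_k + m}` with `|m| ≤ m_a + 1`. [OURS · K2(p) phase d = 2] [folklore] -/
theorem exists_light_witness_local
    (hS : ∀ i, i ≤ 5 → IsIsolated p (s i).F ∧ (∀ e ∈ (s i).F.support, (s i).r ≤ e) ∧
      ordZero (s i).F = (((s i).r.degree + 2 : ℕ) : ℕ∞) ∧ p ≤ (s i).r.degree + 1 ∧ (s i).r.degree + 4 ≤ 2 * p ∧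
      (s i).shade = 2)
    (k : ℕ) (hk : k ≤ 5) (hW : (s k).r.degree + 1 = p) {a : Fin 4} (ha : (s k).r a = 1) : ∃ m : Fin 4 →₀ ℕ, (s k).r + m ∈ (s k).F.support ∧ m.degree ≤ m a + 1 := by
  obtain ⟨hiso, hr, -, -, -, -⟩ := hS k hk
  obtain ⟨e, he, hlt⟩ := exists_degree_lt_apply_add_of_isIsolated hiso a
  have hle : (s k).r ≤ e := hr e he
  obtain ⟨m, rfl⟩ : ∃ m, e = (s k).r + m := ⟨e - (s k).r, (add_tsub_cancel_of_le hle).symm⟩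
  rw [map_add, Finsupp.add_apply] at hlt
  exact ⟨m, he, by omega⟩

/-! ## §3 The switch kill -/

/-- **Forward transport of an explicit monomial** through the corner step at index `k`. [OURS · K2(p) phase d = 2]
[folklore] -/
theorem cornerAt_image_local (hS : ∀ i, i ≤ 5 → IsIsolated p (s i).F ∧ (∀ e ∈ (s i).F.support, (s i).r ≤ e) ∧
      ordZero (s i).F = (((s i).r.degree + 2 : ℕ) : ℕ∞) ∧ p ≤ (s i).r.degree + 1 ∧ (s i).r.degree + 4 ≤ 2 * p ∧
      (s i).shade = 2)
    (hT : ∀ i, i ≤ 4 → s (i + 1) = CentreBlowup.step p Finset.univ (j i) (0 : Fin 4 → K) (s i)) (k : ℕ) (hk : k ≤ 4) {m m' : Fin 4 →₀ ℕ}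
    (hupd : m.update (j k) (m.degree - 2) = m') (hm2 : 2 ≤ m.degree) (hm'4 : m'.degree ≤ 4)
    (hm : (s k).r + m ∈ (s k).F.support) : (s (k + 1)).r + m' ∈ (s (k + 1)).F.support := by
  obtain ⟨-, -, -, -, himg, -⟩ := cornerAtLocal hS hT k hk
  rw [← hupd]
  exact himg m hm2 (by rw [hupd]; exact hm'4) hm

/-- A quadric monomial `x_u x_v` blocks every further corner step in the charts `u, v`. [folklore] -/
theorem not_corner_of_mixed_local (hS : ∀ i, i ≤ 5 → IsIsolated p (s i).F ∧ (∀ e ∈ (s i).F.support, (s i).r ≤ e) ∧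
      ordZero (s i).F = (((s i).r.degree + 2 : ℕ) : ℕ∞) ∧ p ≤ (s i).r.degree + 1 ∧ (s i).r.degree + 4 ≤ 2 * p ∧
      (s i).shade = 2)
    (hT : ∀ i, i ≤ 4 → s (i + 1) = CentreBlowup.step p Finset.univ (j i) (0 : Fin 4 → K) (s i)) (k : ℕ) (hk : k ≤ 4) {u v : Fin 4} (huv : u ≠ v)
    (hjk : j k = u ∨ j k = v)
    (hmem : (s k).r + (Finsupp.single u 1 + Finsupp.single v 1) ∈ (s k).F.support) : False := by
  obtain ⟨-, hfree, -, -, -, -⟩ := cornerAtLocal hS hT k hk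
  refine hfree _ (degree_single_add_single u v 1 1) ?_ hmem
  rcases hjk with h | h <;> rw [h, Finsupp.add_apply, Finsupp.single_apply, Finsupp.single_apply]
  · rw [if_pos rfl]; omega
  · rw [if_neg huv, if_pos rfl]; omega

/-- **The descent `a b² → a b` and `a² b → a b`**: a cubic two-letter monomial over the boundary at a corner step in the
chart of its squared letter breeds the mixed quadric monomial, which blocks the next light corner. [OURS · K2(p) phase
d = 2] [folklore] -/
theorem mixed_of_sq_mul_local (hS : ∀ i, i ≤ 5 → IsIsolated p (s i).F ∧ (∀ e ∈ (s i).F.support, (s i).r ≤ e) ∧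
      ordZero (s i).F = (((s i).r.degree + 2 : ℕ) : ℕ∞) ∧ p ≤ (s i).r.degree + 1 ∧ (s i).r.degree + 4 ≤ 2 * p ∧
      (s i).shade = 2)
    (hT : ∀ i, i ≤ 4 → s (i + 1) = CentreBlowup.step p Finset.univ (j i) (0 : Fin 4 → K) (s i)) (k : ℕ) (hk : k ≤ 4) {a e : Fin 4} (hae : a ≠ e) (hjk : j k = e)
    (hmem : (s k).r + (Finsupp.single a 1 + Finsupp.single e 2) ∈ (s k).F.support) :
    (s (k + 1)).r + (Finsupp.single a 1 + Finsupp.single e 1) ∈ (s (k + 1)).F.support :=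
  cornerAt_image_local hS hT k hk (by rw [hjk, degree_single_add_single, update_single_add_single_right hae])
    (by rw [degree_single_add_single]; omega) (by rw [degree_single_add_single]; omega) hmem

/-- **The descent `a b³ → a b²`**. [OURS · K2(p) phase d = 2] [folklore] -/
theorem sq_mul_of_cube_mul_local (hS : ∀ i, i ≤ 5 → IsIsolated p (s i).F ∧ (∀ e ∈ (s i).F.support, (s i).r ≤ e) ∧
      ordZero (s i).F = (((s i).r.degree + 2 : ℕ) : ℕ∞) ∧ p ≤ (s i).r.degree + 1 ∧ (s i).r.degree + 4 ≤ 2 * p ∧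
      (s i).shade = 2)
    (hT : ∀ i, i ≤ 4 → s (i + 1) = CentreBlowup.step p Finset.univ (j i) (0 : Fin 4 → K) (s i)) (k : ℕ) (hk : k ≤ 4) {a e : Fin 4} (hae : a ≠ e) (hjk : j k = e)
    (hmem : (s k).r + (Finsupp.single a 1 + Finsupp.single e 3) ∈ (s k).F.support) :
    (s (k + 1)).r + (Finsupp.single a 1 + Finsupp.single e 2) ∈ (s (k + 1)).F.support :=
  cornerAt_image_local hS hT k hk (by rw [hjk, degree_single_add_single, update_single_add_single_right hae])
    (by rw [degree_single_add_single]; omega) (by rw [degree_single_add_single]; omega) hmem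

/-- **Persistence `a b² → a b²` under the corner step in the chart of the LINEAR letter `a`**. [OURS · K2(p) phase d = 2]
[folklore] -/
theorem sq_mul_persist_local (hS : ∀ i, i ≤ 5 → IsIsolated p (s i).F ∧ (∀ e ∈ (s i).F.support, (s i).r ≤ e) ∧
      ordZero (s i).F = (((s i).r.degree + 2 : ℕ) : ℕ∞) ∧ p ≤ (s i).r.degree + 1 ∧ (s i).r.degree + 4 ≤ 2 * p ∧
      (s i).shade = 2)
    (hT : ∀ i, i ≤ 4 → s (i + 1) = CentreBlowup.step p Finset.univ (j i) (0 : Fin 4 → K) (s i)) (k : ℕ) (hk : k ≤ 4) {a e : Fin 4} (hae : a ≠ e) (hjk : j k = a)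
    (hmem : (s k).r + (Finsupp.single a 1 + Finsupp.single e 2) ∈ (s k).F.support) :
    (s (k + 1)).r + (Finsupp.single a 1 + Finsupp.single e 2) ∈ (s (k + 1)).F.support :=
  cornerAt_image_local hS hT k hk (by rw [hjk, degree_single_add_single, update_single_add_single_left hae])
    (by rw [degree_single_add_single]; omega) (by rw [degree_single_add_single]; omega) hmem

/-- **After a switch, two more light corners in the charts `u, v` are impossible when `x^{r + u v²}` is present**
(`v`: `uv² ↦ uv`; `u`: the `u`-witness is `u²v ↦ uv` or `u³v ↦ u²v`, then `u²v ↦ uv` / `uv² ↦ uv`). [OURS · K2(p) phase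
d = 2] [folklore] -/
theorem no_two_corners_after_sq_mul_local (hS : ∀ i, i ≤ 5 → IsIsolated p (s i).F ∧ (∀ e ∈ (s i).F.support, (s i).r ≤ e) ∧
      ordZero (s i).F = (((s i).r.degree + 2 : ℕ) : ℕ∞) ∧ p ≤ (s i).r.degree + 1 ∧ (s i).r.degree + 4 ≤ 2 * p ∧
      (s i).shade = 2)
    (hT : ∀ i, i ≤ 4 → s (i + 1) = CentreBlowup.step p Finset.univ (j i) (0 : Fin 4 → K) (s i)) (t : ℕ) (ht : t + 3 ≤ 4) {u v : Fin 4} (huv : u ≠ v) (hjv : j t = v)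
    (hW : (s (t + 1)).r.degree + 1 = p) (hru : (s (t + 1)).r u = 1)
    (hj1 : j (t + 1) = u ∨ j (t + 1) = v) (hj2 : j (t + 2) = u ∨ j (t + 2) = v) (hj3 : j (t + 3) = u ∨ j (t + 3) = v)
    (hmem : (s (t + 1)).r + (Finsupp.single u 1 + Finsupp.single v 2) ∈ (s (t + 1)).F.support) : False := by
  rcases hj1 with hj1 | hj1
  · -- step `t+1` in chart `u`: read the `u`-witness of `c (t+1)` (child of the `v`-step `t`)
    obtain ⟨m₂, hm₂, hlow₂⟩ := exists_light_witness_local hS (t + 1) (by omega) hW hru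
    have huj : u ≠ j t := by rw [hjv]; exact huv
    obtain ⟨-, hfree2, -, -, -, -⟩ := cornerAtLocal hS hT (t + 1) (by omega)
    rcases low_witness_after_corner_local hS hT t (by omega) huj hm₂ hlow₂ with ⟨hdeg2, hu1⟩ | ⟨hm₂eq, -⟩ | ⟨hm₂eq, -⟩
    · exact hfree2 m₂ hdeg2 (by rw [hj1]; omega) hm₂
    · -- `u²v ↦ uv` blocks step `t+2`
      rw [hjv, add_comm] at hm₂eq
      rw [hm₂eq] at hm₂
      exact not_corner_of_mixed_local hS hT (t + 2) (by omega) huv.symm (Or.symm hj2)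
        (mixed_of_sq_mul_local hS hT (t + 1) (by omega) huv.symm hj1 hm₂)
    · -- `u³v ↦ u²v`, `uv² ↦ uv²`; then step `t+2` breeds `uv`, blocking step `t+3`
      rw [hjv, add_comm] at hm₂eq
      rw [hm₂eq] at hm₂
      have h3a := sq_mul_of_cube_mul_local hS hT (t + 1) (by omega) huv.symm hj1 hm₂
      have h3b := sq_mul_persist_local hS hT (t + 1) (by omega) huv hj1 hmem
      rcases hj2 with hj2 | hj2
      · exact not_corner_of_mixed_local hS hT (t + 3) (by omega) huv.symm (Or.symm hj3)
          (mixed_of_sq_mul_local hS hT (t + 2) (by omega) huv.symm hj2 h3a)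
      · exact not_corner_of_mixed_local hS hT (t + 3) (by omega) huv hj3 (mixed_of_sq_mul_local hS hT (t + 2) (by omega) huv hj2 h3b)
  · -- step `t+1` in chart `v`: `uv² ↦ uv` blocks step `t+2`
    exact not_corner_of_mixed_local hS hT (t + 2) (by omega) huv hj2 (mixed_of_sq_mul_local hS hT (t + 1) (by omega) huv hj1 hmem)

/-- **THE SWITCH KILL ON A CORNER WINDOW** (idea-4 I-4-6 (C3-2L) word law, finite and `p`-free): along a witnessed `Step0 p`
chain of isolated shade-`2` states off the floor with `x^{r₀} ∣ F₀`, suppose the states `t+1, t+2` have `W = p − 1` with `v`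
light at `t+1` and `u` light at `t+2` (`u ≠ v`), and the five steps `t, …, t+4` are CORNER steps (`b = 0`) in the charts `u, v`, the first in
`u`, the second in `v`.  Contradiction: the switch `u → v` leaves `v`-witnesses `uv²` or `uv³` only, and the mixed quadric
monomial `uv` they breed within three steps blocks the light corners. [OURS · K2(p) phase d = 2] [folklore] -/
theorem no_corner_switch_window_local (hS : ∀ i, i ≤ 5 → IsIsolated p (s i).F ∧ (∀ e ∈ (s i).F.support, (s i).r ≤ e) ∧
      ordZero (s i).F = (((s i).r.degree + 2 : ℕ) : ℕ∞) ∧ p ≤ (s i).r.degree + 1 ∧ (s i).r.degree + 4 ≤ 2 * p ∧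
      (s i).shade = 2)
    (hT : ∀ i, i ≤ 4 → s (i + 1) = CentreBlowup.step p Finset.univ (j i) (0 : Fin 4 → K) (s i)) {u v : Fin 4} (huv : u ≠ v)
    (hW1 : (s 1).r.degree + 1 = p) (hW2 : (s 2).r.degree + 1 = p)
    (hrv1 : (s 1).r v = 1) (hru2 : (s 2).r u = 1)
    (hju : j 0 = u) (hjv : j 1 = v) (hj2 : j 2 = u ∨ j 2 = v)
    (hj3 : j 3 = u ∨ j 3 = v) (hj4 : j 4 = u ∨ j 4 = v) : False := by
  -- the `v`-witness of `c (t+1)` right after the `u`-step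
  obtain ⟨m₁, hm₁, hlow₁⟩ := exists_light_witness_local hS 1 (by omega) hW1 hrv1
  have hvj : v ≠ j 0 := by rw [hju]; exact huv.symm
  obtain ⟨-, hfree1, -, -, -, -⟩ := cornerAtLocal hS hT 1 (by omega)
  rcases low_witness_after_corner_local hS hT 0 (by omega) hvj hm₁ hlow₁ with ⟨hdeg2, hv1⟩ | ⟨hm₁eq, -⟩ | ⟨hm₁eq, -⟩
  · -- a quadric monomial involving `x_v` at a `v`-step: excluded
    exact hfree1 m₁ hdeg2 (by rw [hjv]; omega) hm₁
  · -- `uv²` at `t+1` ↦ `uv` at `t+2`: blocks step `t+2`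
    rw [hju, add_comm] at hm₁eq
    rw [hm₁eq] at hm₁
    exact not_corner_of_mixed_local hS hT 2 (by omega) huv hj2 (mixed_of_sq_mul_local hS hT 1 (by omega) huv hjv hm₁)
  · -- `uv³` at `t+1` ↦ `uv²` at `t+2`, then `no_two_corners_after_sq_mul_local`
    rw [hju, add_comm] at hm₁eq
    rw [hm₁eq] at hm₁
    exact no_two_corners_after_sq_mul_local hS hT 1 (by omega) huv hjv hW2 hru2 hj2 hj3 hj4
      (sq_mul_of_cube_mul_local hS hT 1 (by omega) huv hjv hm₁)

end Local

end ResCone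

end Summit.ResolutionOfSingularities.ResolutionOfSingularities.Theorems.PIDim4

end
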